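import Literature.NumberTheory.Transcendental.PadicExpClosedBall
import Literature.NumberTheory.Transcendental.PadicLogAlgClProofs
import HarnessLib

/-!
# The `ℓ`-adic logarithm and square root of a principal unit (odd `ℓ`)

Topic `Literature/NumberTheory/Transcendental`; namespace
`Literature.NumberTheory.Transcendental.PadicExp`. For a complete ultrametric normed
`ℚ_ℓ`-algebra field `E` and an ODD prime `ℓ`, the logarithmic series
`plog y = ∑ −(1−y)ⁿ⁺¹/(n+1)` (`IwasawaLog`, Iwasawa 1972 §4.4) and the exponential
(`PadicExpClosedBall.lean`) are mutually inverse isometries between the principal units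
`‖1 − y‖ ≤ ℓ⁻¹` and the closed ball `‖a‖ ≤ ℓ⁻¹` (Yu, *Linear forms in p-adic logarithms II*,
§1.1; Koblitz GTM 58 Ch. IV §1–2). This is the normalisation used by the `ℓ`-adic theory of
linear forms in logarithms of rational numbers `α ≡ 1 (mod ℓ)`: `log_ℓ α := plog α` has norm
`‖α − 1‖ ≤ ℓ⁻¹`, `exp (s · plog α) = αˢ`, and the PRINCIPAL square root
`psqrt α = exp (½ plog α) ≡ 1 (mod ℓ)` satisfies `psqrt α · psqrt α = α` and
`exp ((s/2) plog α) = (psqrt α)ˢ` — the values of the auxiliary functions of the `2`-descent at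
the half-integers.

* `plog`, `hasSum_plog`, `plog_one`, `plog_mul`, `plog_inv`, `plog_pow` (functional equations,
  from `IwasawaLog.logSeries_mul`);
* `norm_plog_add_one_sub_lt`, `norm_plog` — `‖plog y‖ = ‖1 − y‖` for `‖1 − y‖ ≤ ℓ⁻¹`;
* `plog_exp` — `plog (exp a) = a` for `‖a‖ ≤ ℓ⁻¹`; `exp_plog` — `exp (plog y) = y`;
  `plog_injOn`;
* `psqrt`, `psqrt_mul_self`, `norm_psqrt_sub_one`, `exp_natCast_mul_plog`,
  `exp_natCast_mul_half_plog`.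

## References
* K. Iwasawa, *Lectures on p-adic L-functions*, Ann. of Math. Stud. 74 (1972), §4.4.
* N. Koblitz, *p-adic Numbers, p-adic Analysis, and Zeta-Functions*, GTM 58 (1984), Ch. IV §1–2.
* Kunrui Yu, *Linear forms in p-adic logarithms II*, Compositio Math. 74 (1990), §1.1.
-/

noncomputable section

open NormedSpace Filter Topology Metric IsUltrametricDist Finset
open scoped Nat

namespace Literature.NumberTheory.Transcendental

namespace PadicExp

variable {ℓ : ℕ} [Fact ℓ.Prime]
variable {E : Type*} [NontriviallyNormedField E] [NormedAlgebra ℚ_[ℓ] E]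

/-! ### The logarithmic series -/

/-- **The `ℓ`-adic logarithm of a principal unit**: the logarithmic series
`plog y = ∑_{n ≥ 0} −(1 − y)ⁿ⁺¹/(n + 1) = −∑_{k ≥ 1} (1−y)ᵏ/k`. [cite: Koblitz1984, Ch. IV §1] -/
def plog (y : E) : E := ∑' n : ℕ, -((1 - y) ^ (n + 1)) / (n + 1 : E)

/-- `plog 1 = 0`. [cite: Koblitz1984, Ch. IV §1] -/
@[simp] theorem plog_one : plog (1 : E) = 0 := by
  unfold plog; simp

include ℓ in
/-- `‖2‖ = 1` in a normed `ℚ_ℓ`-algebra field, `ℓ` odd. [cite: Koblitz1984, Ch. I §2] -/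
theorem norm_two_eq_one (hℓ : 3 ≤ ℓ) : ‖(2 : E)‖ = 1 := by
  have hp : ℓ.Prime := Fact.out
  rw [show (2 : E) = ((2 : ℕ) : E) by norm_cast, norm_natCast (ℓ := ℓ),
    Padic.norm_natCast_eq_one_iff]
  exact (Nat.coprime_primes hp Nat.prime_two).mpr (by omega)

include ℓ in
/-- `2 ≠ 0` in a normed `ℚ_ℓ`-algebra field. [cite: Koblitz1984, Ch. I §2] -/
theorem two_ne_zero' (hℓ : 3 ≤ ℓ) : (2 : E) ≠ 0 :=
  norm_pos_iff.mp (by rw [norm_two_eq_one (ℓ := ℓ) hℓ]; exact one_pos)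

include ℓ in
/-- `‖2⁻¹‖ = 1` in a normed `ℚ_ℓ`-algebra field, `ℓ` odd. [cite: Koblitz1984, Ch. I §2] -/
theorem norm_inv_two_eq_one (hℓ : 3 ≤ ℓ) : ‖(2 : E)⁻¹‖ = 1 := by
  rw [norm_inv, norm_two_eq_one (ℓ := ℓ) hℓ, inv_one]

section Complete

variable [CompleteSpace E]

include ℓ in
/-- The logarithmic series converges for `‖1 − y‖ < 1`. [cite: Koblitz1984, Ch. IV §1] -/
theorem hasSum_plog {y : E} (hy : ‖1 - y‖ < 1) :
    HasSum (fun n : ℕ => -((1 - y) ^ (n + 1)) / (n + 1 : E)) (plog y) :=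
  (IwasawaLog.summable_logTerm (p := ℓ) hy).hasSum

variable [IsUltrametricDist E]

include ℓ in
/-- **Functional equation** `plog (y₁ y₂) = plog y₁ + plog y₂` for principal units
(`IwasawaLog.logSeries_mul`). [cite: Koblitz1984, Ch. IV §1] -/
theorem plog_mul {y₁ y₂ : E} (h₁ : ‖1 - y₁‖ < 1) (h₂ : ‖1 - y₂‖ < 1) :
    plog (y₁ * y₂) = plog y₁ + plog y₂ :=
  IwasawaLog.logSeries_mul (p := ℓ) h₁ h₂

include ℓ in
/-- `plog (yᵏ) = k · plog y`. [cite: Koblitz1984, Ch. IV §1] -/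
theorem plog_pow {y : E} (h : ‖1 - y‖ < 1) (k : ℕ) : plog (y ^ k) = k * plog y :=
  IwasawaLog.logSeries_pow (p := ℓ) h k

include ℓ in
/-- `plog (y⁻¹) = −plog y`. [cite: Koblitz1984, Ch. IV §1] -/
theorem plog_inv {y : E} (h : ‖1 - y‖ < 1) : plog y⁻¹ = -plog y := by
  have hy1 := IwasawaLog.norm_eq_one_of_norm_one_sub_lt h
  have hy0 : y ≠ 0 := norm_pos_iff.mp (by rw [hy1]; exact one_pos)
  have hinv := IwasawaLog.norm_one_sub_inv_lt h
  have := plog_mul (ℓ := ℓ) h hinv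
  rw [mul_inv_cancel₀ hy0, plog_one] at this
  linear_combination -this

include ℓ in
/-- `plog (yᶻ) = z · plog y` for `z ∈ ℤ`. [cite: Koblitz1984, Ch. IV §1] -/
theorem plog_zpow {y : E} (h : ‖1 - y‖ < 1) (z : ℤ) : plog (y ^ z) = z * plog y := by
  obtain ⟨n, rfl | rfl⟩ := z.eq_nat_or_neg
  · rw [zpow_natCast, plog_pow (ℓ := ℓ) h, Int.cast_natCast]
  · rw [zpow_neg, zpow_natCast, plog_inv (ℓ := ℓ) (IwasawaLog.norm_one_sub_pow_lt h n),
      plog_pow (ℓ := ℓ) h, Int.cast_neg, Int.cast_natCast, neg_mul]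

omit [CompleteSpace E] in
/-- Principal units are closed under integer powers. [cite: Koblitz1984, Ch. IV §1] -/
theorem norm_one_sub_zpow_lt {y : E} (h : ‖1 - y‖ < 1) (z : ℤ) : ‖1 - y ^ z‖ < 1 := by
  obtain ⟨n, rfl | rfl⟩ := z.eq_nat_or_neg
  · rw [zpow_natCast]; exact IwasawaLog.norm_one_sub_pow_lt h n
  · rw [zpow_neg, zpow_natCast]
    exact IwasawaLog.norm_one_sub_inv_lt (IwasawaLog.norm_one_sub_pow_lt h n)

include ℓ in
/-- **`plog` of a product of integer powers of principal units**:
`plog (∏ yᵢ^{zᵢ}) = ∑ zᵢ plog yᵢ`. [cite: Koblitz1984, Ch. IV §1] -/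
theorem plog_prod_zpow {ι : Type*} (t : Finset ι) (y : ι → E) (z : ι → ℤ)
    (hy : ∀ i ∈ t, ‖1 - y i‖ < 1) :
    plog (∏ i ∈ t, y i ^ z i) = ∑ i ∈ t, (z i : E) * plog (y i) := by
  classical
  -- joint induction: the product of the powers stays a principal unit (finite products of
  -- principal units are principal units, `LogE.norm_one_sub_prod_lt` in the tree) and `plog` adds up
  suffices h : ‖1 - ∏ i ∈ t, y i ^ z i‖ < 1 ∧
      plog (∏ i ∈ t, y i ^ z i) = ∑ i ∈ t, (z i : E) * plog (y i) from h.2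
  induction t using Finset.induction_on with
  | empty => simp
  | insert j t hj ih =>
    have hyj := hy j (Finset.mem_insert_self j t)
    have hrest : ∀ i ∈ t, ‖1 - y i‖ < 1 := fun i hi => hy i (Finset.mem_insert_of_mem hi)
    obtain ⟨hprod, heq⟩ := ih hrest
    refine ⟨?_, ?_⟩
    · rw [prod_insert hj]
      exact IwasawaLog.norm_one_sub_mul_lt (norm_one_sub_zpow_lt hyj _) hprod
    · rw [prod_insert hj, sum_insert hj, plog_mul (ℓ := ℓ) (norm_one_sub_zpow_lt hyj _) hprod,
        plog_zpow (ℓ := ℓ) hyj, heq]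

/-! ### Principal units of level `r`: closure properties -/

omit [CompleteSpace E] in
/-- `‖1 − y₁ y₂‖ ≤ r` if `‖1 − yᵢ‖ ≤ r` (`r < 1`). [cite: Koblitz1984, Ch. IV §1] -/
theorem norm_one_sub_mul_le {r : ℝ} (hr : r < 1) {y₁ y₂ : E} (h₁ : ‖1 - y₁‖ ≤ r)
    (h₂ : ‖1 - y₂‖ ≤ r) : ‖1 - y₁ * y₂‖ ≤ r := by
  have : 1 - y₁ * y₂ = (1 - y₁) + y₁ * (1 - y₂) := by ring
  rw [this]
  refine (norm_add_le_max _ _).trans (max_le h₁ ?_)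
  rw [norm_mul, IwasawaLog.norm_eq_one_of_norm_one_sub_lt (h₁.trans_lt hr), one_mul]
  exact h₂

omit [CompleteSpace E] in
/-- `‖1 − y⁻¹‖ ≤ r` if `‖1 − y‖ ≤ r` (`r < 1`). [cite: Koblitz1984, Ch. IV §1] -/
theorem norm_one_sub_inv_le {r : ℝ} (hr : r < 1) {y : E} (h : ‖1 - y‖ ≤ r) :
    ‖1 - y⁻¹‖ ≤ r := by
  have hy1 := IwasawaLog.norm_eq_one_of_norm_one_sub_lt (h.trans_lt hr)
  have hy0 : y ≠ 0 := norm_pos_iff.mp (by rw [hy1]; exact one_pos)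
  have : 1 - y⁻¹ = -(y⁻¹ * (1 - y)) := by field_simp; ring
  rw [this, norm_neg, norm_mul, norm_inv, hy1, inv_one, one_mul]
  exact h

omit [CompleteSpace E] in
/-- `‖1 − yᶻ‖ ≤ r` for `z ∈ ℤ` if `‖1 − y‖ ≤ r` (`0 ≤ r < 1`). [cite: Koblitz1984, Ch. IV §1] -/
theorem norm_one_sub_zpow_le {r : ℝ} (hr0 : 0 ≤ r) (hr : r < 1) {y : E} (h : ‖1 - y‖ ≤ r)
    (z : ℤ) : ‖1 - y ^ z‖ ≤ r := by
  have hpow : ∀ n : ℕ, ‖1 - y ^ n‖ ≤ r := by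
    intro n
    induction n with
    | zero => simpa using hr0
    | succ n ih => rw [pow_succ]; exact norm_one_sub_mul_le hr ih h
  obtain ⟨n, rfl | rfl⟩ := z.eq_nat_or_neg
  · rw [zpow_natCast]; exact hpow n
  · rw [zpow_neg, zpow_natCast]; exact norm_one_sub_inv_le hr (hpow n)

omit [CompleteSpace E] in
/-- `‖1 − ∏ yᵢ^{zᵢ}‖ ≤ r` if all `‖1 − yᵢ‖ ≤ r` (`0 ≤ r < 1`). [cite: Koblitz1984, Ch. IV §1] -/
theorem norm_one_sub_prod_zpow_le {r : ℝ} (hr0 : 0 ≤ r) (hr : r < 1) {ι : Type*}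
    (t : Finset ι) (y : ι → E) (z : ι → ℤ) (hy : ∀ i ∈ t, ‖1 - y i‖ ≤ r) :
    ‖1 - ∏ i ∈ t, y i ^ z i‖ ≤ r := by
  classical
  induction t using Finset.induction_on with
  | empty => simpa using hr0
  | insert j t hj ih =>
    rw [prod_insert hj]
    exact norm_one_sub_mul_le hr (norm_one_sub_zpow_le hr0 hr (hy j (mem_insert_self j t)) _)
      (ih fun i hi => hy i (mem_insert_of_mem hi))

/-- `exp` of a finite sum in the closed ball is the product (`ℓ` odd). [cite: Koblitz1984, Ch. IV §1] -/
theorem exp_sum_of_norm_le (hℓ : 3 ≤ ℓ) {ι : Type*} (t : Finset ι) (a : ι → E)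
    (ha : ∀ i ∈ t, ‖a i‖ ≤ (ℓ : ℝ)⁻¹) : exp (∑ i ∈ t, a i) = ∏ i ∈ t, exp (a i) := by
  classical
  induction t using Finset.induction_on with
  | empty => simp
  | insert j t hj ih =>
    have hrest : ‖∑ i ∈ t, a i‖ ≤ (ℓ : ℝ)⁻¹ :=
      norm_sum_le_of_forall_le_of_nonneg (by positivity) fun i hi => ha i (mem_insert_of_mem hi)
    rw [sum_insert hj, prod_insert hj, exp_add_of_norm_le hℓ (ha j (mem_insert_self j t)) hrest,
      ih fun i hi => ha i (mem_insert_of_mem hi)]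

/-! ### `plog` is an isometry on the principal units `‖1 − y‖ ≤ ℓ⁻¹` -/

/-- The dominant term: `‖plog y + (1 − y)‖ ≤ (2/ℓ) ‖1 − y‖` for `‖1 − y‖ ≤ ℓ⁻¹`
(each term `(1−y)ⁿ⁺¹/(n+1)`, `n ≥ 1`, has norm `≤ (n+1) ℓ^{-n} ‖1−y‖ ≤ (2/ℓ)‖1−y‖`).
[cite: Koblitz1984, Ch. IV §1] -/
theorem norm_plog_add_one_sub_le {y : E} (hy : ‖1 - y‖ ≤ (ℓ : ℝ)⁻¹) :
    ‖plog y + (1 - y)‖ ≤ 2 / ℓ * ‖1 - y‖ := by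
  have hp : ℓ.Prime := Fact.out
  have hℓ1 : (1 : ℝ) < ℓ := by exact_mod_cast hp.one_lt
  have hℓ0 : (0 : ℝ) < ℓ := by linarith
  have ht1 : ‖1 - y‖ < 1 := hy.trans_lt (inv_lt_one_of_one_lt₀ hℓ1)
  have hs := hasSum_plog (ℓ := ℓ) ht1
  have hs1 : HasSum (fun n : ℕ => -((1 - y) ^ (n + 2)) / (n + 2 : E)) (plog y + (1 - y)) := by
    have h := (hasSum_nat_add_iff' 1).mpr hs
    simp only [Finset.sum_range_one, zero_add, pow_one, Nat.cast_zero, div_one] at h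
    have e2 : plog y + (1 - y) = plog y - -(1 - y) := by ring
    have ef : (fun n : ℕ => -((1 - y) ^ (n + 2)) / (n + 2 : E)) =
        (fun n : ℕ => -(1 - y) ^ (n + 1 + 1) / ((n + 1 : ℕ) + 1 : E)) := by
      funext n; push_cast; ring_nf
    rw [e2, ef]; exact h
  rw [← hs1.tsum_eq]
  refine norm_tsum_le_of_forall_le_of_nonneg (by positivity) fun n => ?_
  have hterm := IwasawaLog.norm_logTerm_le (p := ℓ) (F := E) (1 - y) (n + 1)
  have e1 : -((1 - y) ^ (n + 1 + 1)) / ((n + 1 : ℕ) + 1 : E) = -((1 - y) ^ (n + 2)) / (n + 2 : E) := by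
    push_cast; ring_nf
  rw [e1] at hterm
  refine hterm.trans ?_
  -- `(n+2) ‖t‖^{n+2} ≤ (n+2) ℓ^{-(n+1)} ‖t‖ ≤ (2/ℓ) ‖t‖`
  have hnn : 0 ≤ ‖1 - y‖ := norm_nonneg _
  have hpow : ‖1 - y‖ ^ (n + 2) ≤ ((ℓ : ℝ)⁻¹) ^ (n + 1) * ‖1 - y‖ := by
    rw [pow_succ]
    exact mul_le_mul_of_nonneg_right (pow_le_pow_left₀ hnn hy _) hnn
  have hcoef : ((n + 1 + 1 : ℕ) : ℝ) * ((ℓ : ℝ)⁻¹) ^ (n + 1) ≤ 2 / ℓ := by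
    have hnat : n + 2 ≤ 2 * ℓ ^ n := by
      have h1 : n + 1 < 2 ^ (n + 1) := (n + 1).lt_two_pow_self
      have h2 : 2 ^ n ≤ ℓ ^ n := Nat.pow_le_pow_left hp.two_le n
      rw [pow_succ] at h1
      omega
    have hR : ((n : ℝ) + 2) * ℓ ≤ 2 * (ℓ : ℝ) ^ n * ℓ := by
      have : ((n + 2 : ℕ) : ℝ) ≤ ((2 * ℓ ^ n : ℕ) : ℝ) := by exact_mod_cast hnat
      push_cast at this
      exact mul_le_mul_of_nonneg_right this hℓ0.le
    rw [inv_pow, ← div_eq_mul_inv, div_le_div_iff₀ (by positivity) hℓ0]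
    push_cast
    calc ((n : ℝ) + 1 + 1) * ℓ = ((n : ℝ) + 2) * ℓ := by ring
      _ ≤ 2 * (ℓ : ℝ) ^ n * ℓ := hR
      _ = 2 * (ℓ : ℝ) ^ (n + 1) := by ring
  calc ((n + 1 + 1 : ℕ) : ℝ) * ‖1 - y‖ ^ (n + 1 + 1)
      = ((n + 1 + 1 : ℕ) : ℝ) * ‖1 - y‖ ^ (n + 2) := by ring_nf
    _ ≤ ((n + 1 + 1 : ℕ) : ℝ) * (((ℓ : ℝ)⁻¹) ^ (n + 1) * ‖1 - y‖) :=
        mul_le_mul_of_nonneg_left hpow (by positivity)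
    _ = (((n + 1 + 1 : ℕ) : ℝ) * ((ℓ : ℝ)⁻¹) ^ (n + 1)) * ‖1 - y‖ := by ring
    _ ≤ 2 / ℓ * ‖1 - y‖ := mul_le_mul_of_nonneg_right hcoef hnn

/-- **`‖plog y‖ = ‖1 − y‖`** for `‖1 − y‖ ≤ ℓ⁻¹`, `ℓ` odd. [cite: Koblitz1984, Ch. IV §1] -/
theorem norm_plog (hℓ : 3 ≤ ℓ) {y : E} (hy : ‖1 - y‖ ≤ (ℓ : ℝ)⁻¹) : ‖plog y‖ = ‖1 - y‖ := by
  have hp : ℓ.Prime := Fact.out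
  have hℓ0 : (0 : ℝ) < ℓ := by exact_mod_cast hp.pos
  by_cases ht0 : 1 - y = 0
  · have : y = 1 := by rw [sub_eq_zero] at ht0; exact ht0.symm
    rw [this, plog_one, sub_self]
  have hpos : 0 < ‖1 - y‖ := norm_pos_iff.mpr ht0
  have hlt : ‖plog y + (1 - y)‖ < ‖1 - y‖ := by
    refine (norm_plog_add_one_sub_le (ℓ := ℓ) hy).trans_lt ?_
    have : (2 : ℝ) / ℓ < 1 := by rw [div_lt_one hℓ0]; exact_mod_cast (by omega : 2 < ℓ)
    calc 2 / ℓ * ‖1 - y‖ < 1 * ‖1 - y‖ := mul_lt_mul_of_pos_right this hpos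
      _ = ‖1 - y‖ := one_mul _
  have e : plog y = (plog y + (1 - y)) + (-(1 - y)) := by ring
  rw [e]
  have hne : ‖plog y + (1 - y)‖ ≠ ‖-(1 - y)‖ := by rw [norm_neg]; exact hlt.ne
  rw [norm_add_eq_max_of_norm_ne_norm hne, norm_neg, max_eq_right hlt.le]

/-! ### `plog` inverts `exp` on the closed ball -/

/-- **`plog (exp a) = a`** for `‖a‖ ≤ ℓ⁻¹`, `ℓ` odd: both sides are the limit of
`((exp a)^{ℓ^k} − 1)/ℓ^k = (exp (ℓ^k a) − 1)/ℓ^k` (the limit formula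
`IwasawaLog.tendsto_pow_prime_pow_sub_one_div` and `‖exp b − 1 − b‖ ≤ ℓ‖b‖²`).
[cite: Koblitz1984, Ch. IV §1] -/
theorem plog_exp (hℓ : 3 ≤ ℓ) {a : E} (ha : ‖a‖ ≤ (ℓ : ℝ)⁻¹) : plog (exp a) = a := by
  have hp : ℓ.Prime := Fact.out
  have hℓ0 : (0 : ℝ) < ℓ := by exact_mod_cast hp.pos
  have hℓinv1 : (ℓ : ℝ)⁻¹ < 1 := inv_lt_one_of_one_lt₀ (by exact_mod_cast hp.one_lt)
  have hy : ‖1 - exp a‖ < 1 := by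
    rw [norm_sub_rev, norm_exp_sub_one_of_norm_le hℓ ha]; exact ha.trans_lt hℓinv1
  have hlim := IwasawaLog.tendsto_pow_prime_pow_sub_one_div (p := ℓ) (exp a) hy
  change Tendsto _ atTop (𝓝 (plog (exp a))) at hlim
  have hP0 : ∀ k : ℕ, ((ℓ : E) ^ k) ≠ 0 := fun k =>
    pow_ne_zero k (norm_pos_iff.mp (by rw [norm_natCast_prime (ℓ := ℓ)]; positivity))
  have hnormP : ∀ k : ℕ, ‖(ℓ : E) ^ k‖ = ((ℓ : ℝ)⁻¹) ^ k := fun k => by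
    rw [norm_pow, norm_natCast_prime (ℓ := ℓ)]
  -- for `k ≥ 1` the point `ℓ^k a` is in the OPEN ball
  have hak : ∀ k : ℕ, 1 ≤ k → ‖(ℓ : E) ^ k * a‖ < (ℓ : ℝ)⁻¹ := fun k hk => by
    rw [norm_mul, hnormP]
    calc ((ℓ : ℝ)⁻¹) ^ k * ‖a‖ ≤ (ℓ : ℝ)⁻¹ * ‖a‖ := by
          refine mul_le_mul_of_nonneg_right ?_ (norm_nonneg _)
          calc ((ℓ : ℝ)⁻¹) ^ k ≤ ((ℓ : ℝ)⁻¹) ^ 1 :=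
                pow_le_pow_of_le_one (by positivity) hℓinv1.le hk
            _ = (ℓ : ℝ)⁻¹ := pow_one _
      _ ≤ (ℓ : ℝ)⁻¹ * (ℓ : ℝ)⁻¹ := mul_le_mul_of_nonneg_left ha (by positivity)
      _ < 1 * (ℓ : ℝ)⁻¹ := mul_lt_mul_of_pos_right hℓinv1 (by positivity)
      _ = (ℓ : ℝ)⁻¹ := one_mul _
  have hak' : ∀ k : ℕ, ‖(ℓ : E) ^ k * a‖ ≤ (ℓ : ℝ)⁻¹ := fun k => by
    rw [norm_mul, hnormP]
    exact (mul_le_of_le_one_left (norm_nonneg _) (pow_le_one₀ (by positivity) hℓinv1.le)).trans ha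
  have heq : ∀ k : ℕ, ((exp a) ^ (ℓ ^ k) - 1) / (ℓ : E) ^ k - a =
      (exp ((ℓ : E) ^ k * a) - 1 - (ℓ : E) ^ k * a) / (ℓ : E) ^ k := by
    intro k
    have e1 : (exp a) ^ (ℓ ^ k) = exp ((ℓ : E) ^ k * a) := by
      rw [← exp_natCast_mul_of_norm_le hℓ ha (ℓ ^ k)]; push_cast; rfl
    rw [e1]; field_simp [hP0 k]
  have hlim' : Tendsto (fun k : ℕ => ((exp a) ^ (ℓ ^ k) - 1) / (ℓ : E) ^ k) atTop (𝓝 a) := by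
    have hzero : Tendsto (fun k : ℕ => ((exp a) ^ (ℓ ^ k) - 1) / (ℓ : E) ^ k - a) atTop (𝓝 0) := by
      have hgeom : Tendsto (fun k : ℕ => ((ℓ : ℝ)⁻¹) ^ k * (‖a‖ * (‖a‖ * ℓ))) atTop (𝓝 0) := by
        have := (tendsto_pow_atTop_nhds_zero_of_lt_one (by positivity) hℓinv1).mul_const
          (‖a‖ * (‖a‖ * ℓ))
        simpa using this
      refine squeeze_zero_norm' ?_ hgeom
      filter_upwards [Filter.eventually_ge_atTop 1] with k hk
      rw [heq k, norm_div, hnormP k]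
      have h1 := norm_exp_sub_one_sub_self_le (ℓ := ℓ) (hak k hk)
      have hPk : 0 < ((ℓ : ℝ)⁻¹) ^ k := by positivity
      rw [div_le_iff₀ hPk]
      refine h1.trans (le_of_eq ?_)
      rw [norm_mul, hnormP k]; ring
    simpa using hzero.add_const a
  exact tendsto_nhds_unique hlim hlim'

/-- **`exp (plog y) = y`** for `‖1 − y‖ ≤ ℓ⁻¹`, `ℓ` odd (so `exp` maps the closed ball
`‖a‖ ≤ ℓ⁻¹` ONTO the principal units `≡ 1 (mod ℓ)`): `y' = exp (plog y)` is a principal unit with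
`plog y' = plog y`, and `plog` is injective there since `‖plog (y'/y)‖ = ‖1 − y'/y‖`.
[cite: Koblitz1984, Ch. IV §2] -/
theorem exp_plog (hℓ : 3 ≤ ℓ) {y : E} (hy : ‖1 - y‖ ≤ (ℓ : ℝ)⁻¹) : exp (plog y) = y := by
  have hp : ℓ.Prime := Fact.out
  have hℓinv1 : (ℓ : ℝ)⁻¹ < 1 := inv_lt_one_of_one_lt₀ (by exact_mod_cast hp.one_lt)
  have hy1 : ‖1 - y‖ < 1 := hy.trans_lt hℓinv1
  have hny : ‖y‖ = 1 := IwasawaLog.norm_eq_one_of_norm_one_sub_lt hy1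
  have hy0 : y ≠ 0 := norm_pos_iff.mp (by rw [hny]; exact one_pos)
  have hL : ‖plog y‖ ≤ (ℓ : ℝ)⁻¹ := by rw [norm_plog hℓ hy]; exact hy
  set y' : E := exp (plog y) with hy'
  have hy'1 : ‖1 - y'‖ ≤ (ℓ : ℝ)⁻¹ := by
    rw [norm_sub_rev, hy', norm_exp_sub_one_of_norm_le hℓ hL, norm_plog hℓ hy]; exact hy
  have hlog : plog y' = plog y := plog_exp hℓ hL
  -- `plog (y' y⁻¹) = 0`
  have hq1 : ‖1 - y' * y⁻¹‖ ≤ (ℓ : ℝ)⁻¹ := by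
    have e : 1 - y' * y⁻¹ = y⁻¹ * ((1 - y') + -(1 - y)) := by field_simp; ring
    rw [e, norm_mul, norm_inv, hny, inv_one, one_mul]
    refine (norm_add_le_max _ _).trans (max_le hy'1 ?_)
    rw [norm_neg]; exact hy
  have hzero : plog (y' * y⁻¹) = 0 := by
    rw [plog_mul (ℓ := ℓ) (hy'1.trans_lt hℓinv1) (IwasawaLog.norm_one_sub_inv_lt hy1),
      plog_inv (ℓ := ℓ) hy1, hlog, add_neg_cancel]
  have : ‖1 - y' * y⁻¹‖ = 0 := by rw [← norm_plog hℓ hq1, hzero, norm_zero]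
  have h1 : y' * y⁻¹ = 1 := by
    have := norm_eq_zero.mp this
    rw [sub_eq_zero] at this; exact this.symm
  calc y' = y' * y⁻¹ * y := by field_simp
    _ = y := by rw [h1, one_mul]

/-- **`plog` is injective on the principal units** `‖1 − y‖ ≤ ℓ⁻¹`, `ℓ` odd.
[cite: Koblitz1984, Ch. IV §2] -/
theorem plog_injOn (hℓ : 3 ≤ ℓ) : Set.InjOn (plog : E → E) {y : E | ‖1 - y‖ ≤ (ℓ : ℝ)⁻¹} := by
  intro y₁ h₁ y₂ h₂ h
  rw [← exp_plog hℓ (y := y₁) h₁, ← exp_plog hℓ (y := y₂) h₂]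
  exact congrArg exp h

/-- **Interpolation of powers**: `exp (s · plog y) = yˢ` (`s ∈ ℕ`) for a principal unit `y`,
`ℓ` odd. [cite: Koblitz1984, Ch. IV §2] -/
theorem exp_natCast_mul_plog (hℓ : 3 ≤ ℓ) {y : E} (hy : ‖1 - y‖ ≤ (ℓ : ℝ)⁻¹) (s : ℕ) :
    exp ((s : E) * plog y) = y ^ s := by
  have hL : ‖plog y‖ ≤ (ℓ : ℝ)⁻¹ := by rw [norm_plog hℓ hy]; exact hy
  rw [exp_natCast_mul_of_norm_le hℓ hL, exp_plog hℓ hy]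

/-- `exp (z · plog y) = yᶻ` (`z ∈ ℤ`) for a principal unit `y`, `ℓ` odd. [cite: Koblitz1984, Ch. IV §2] -/
theorem exp_intCast_mul_plog (hℓ : 3 ≤ ℓ) {y : E} (hy : ‖1 - y‖ ≤ (ℓ : ℝ)⁻¹) (z : ℤ) :
    exp ((z : E) * plog y) = y ^ z := by
  have hL : ‖plog y‖ ≤ (ℓ : ℝ)⁻¹ := by rw [norm_plog hℓ hy]; exact hy
  rw [exp_intCast_mul_of_norm_le hℓ hL, exp_plog hℓ hy]

/-! ### The principal square root -/

/-- **The principal square root** of a principal unit: `psqrt y = exp (½ · plog y)`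
(`≡ 1 (mod ℓ)`, `ℓ` odd). [cite: Koblitz1984, Ch. IV §2] -/
def psqrt (y : E) : E := exp ((2 : E)⁻¹ * plog y)

/-- `‖½ plog y‖ = ‖1 − y‖ ≤ ℓ⁻¹`. [cite: Koblitz1984, Ch. IV §2] -/
theorem norm_inv_two_mul_plog (hℓ : 3 ≤ ℓ) {y : E} (hy : ‖1 - y‖ ≤ (ℓ : ℝ)⁻¹) :
    ‖(2 : E)⁻¹ * plog y‖ = ‖1 - y‖ := by
  rw [norm_mul, norm_inv_two_eq_one (ℓ := ℓ) hℓ, one_mul, norm_plog hℓ hy]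

/-- **`psqrt y · psqrt y = y`.** [cite: Koblitz1984, Ch. IV §2] -/
theorem psqrt_mul_self (hℓ : 3 ≤ ℓ) {y : E} (hy : ‖1 - y‖ ≤ (ℓ : ℝ)⁻¹) :
    psqrt y * psqrt y = y := by
  have hh : ‖(2 : E)⁻¹ * plog y‖ ≤ (ℓ : ℝ)⁻¹ := by rw [norm_inv_two_mul_plog hℓ hy]; exact hy
  unfold psqrt
  rw [← exp_add_of_norm_le hℓ hh hh, ← two_mul, ← mul_assoc, mul_inv_cancel₀ (two_ne_zero' (ℓ := ℓ) hℓ),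
    one_mul, exp_plog hℓ hy]

/-- `psqrt y ^ 2 = y`. [cite: Koblitz1984, Ch. IV §2] -/
theorem psqrt_sq (hℓ : 3 ≤ ℓ) {y : E} (hy : ‖1 - y‖ ≤ (ℓ : ℝ)⁻¹) : psqrt y ^ 2 = y := by
  rw [sq, psqrt_mul_self hℓ hy]

/-- `psqrt y` is a principal unit: `‖psqrt y − 1‖ = ‖1 − y‖`. [cite: Koblitz1984, Ch. IV §2] -/
theorem norm_psqrt_sub_one (hℓ : 3 ≤ ℓ) {y : E} (hy : ‖1 - y‖ ≤ (ℓ : ℝ)⁻¹) :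
    ‖psqrt y - 1‖ = ‖1 - y‖ := by
  have hh : ‖(2 : E)⁻¹ * plog y‖ ≤ (ℓ : ℝ)⁻¹ := by rw [norm_inv_two_mul_plog hℓ hy]; exact hy
  unfold psqrt
  rw [norm_exp_sub_one_of_norm_le hℓ hh, norm_inv_two_mul_plog hℓ hy]

/-- `‖psqrt y‖ = 1`. [cite: Koblitz1984, Ch. IV §2] -/
theorem norm_psqrt (hℓ : 3 ≤ ℓ) {y : E} (hy : ‖1 - y‖ ≤ (ℓ : ℝ)⁻¹) : ‖psqrt y‖ = 1 := by
  have hh : ‖(2 : E)⁻¹ * plog y‖ ≤ (ℓ : ℝ)⁻¹ := by rw [norm_inv_two_mul_plog hℓ hy]; exact hy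
  unfold psqrt
  exact norm_exp_of_norm_le hℓ hh

/-- `psqrt y ≠ 0`. [cite: Koblitz1984, Ch. IV §2] -/
theorem psqrt_ne_zero (hℓ : 3 ≤ ℓ) {y : E} (hy : ‖1 - y‖ ≤ (ℓ : ℝ)⁻¹) : psqrt y ≠ 0 :=
  norm_pos_iff.mp (by rw [norm_psqrt hℓ hy]; exact one_pos)

/-- **Interpolation at the half-integers**: `exp (s · ½ plog y) = (psqrt y)ˢ` (`s ∈ ℕ`).
[cite: Koblitz1984, Ch. IV §2] -/
theorem exp_natCast_mul_half_plog (hℓ : 3 ≤ ℓ) {y : E} (hy : ‖1 - y‖ ≤ (ℓ : ℝ)⁻¹) (s : ℕ) :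
    exp ((s : E) * ((2 : E)⁻¹ * plog y)) = psqrt y ^ s := by
  have hh : ‖(2 : E)⁻¹ * plog y‖ ≤ (ℓ : ℝ)⁻¹ := by rw [norm_inv_two_mul_plog hℓ hy]; exact hy
  unfold psqrt
  exact exp_natCast_mul_of_norm_le hℓ hh s

/-- At an even multiple the half-point value is a power of `y`: `(psqrt y)^{2k} = yᵏ`.
[cite: Koblitz1984, Ch. IV §2] -/
theorem psqrt_pow_two_mul (hℓ : 3 ≤ ℓ) {y : E} (hy : ‖1 - y‖ ≤ (ℓ : ℝ)⁻¹) (k : ℕ) :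
    psqrt y ^ (2 * k) = y ^ k := by
  rw [pow_mul, psqrt_sq hℓ hy]

end Complete

end PadicExp

end Literature.NumberTheory.Transcendental

end
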